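import Summits.Ventures.CertifiedArithmetic.LowPrec.Conversion
import Summits.Ventures.CertifiedArithmetic.LowPrec.Directed
import Summits.Ventures.CertifiedArithmetic.LowPrec.Monotone
import Summits.Ventures.CertifiedArithmetic.LowPrec.Sterbenz
import Summits.Ventures.CertifiedArithmetic.LowPrec.ErrorFreeAdd

/-!
# Successor structure of a minifloat value set; the round-down bracket; midpoints

HONEST FRAMING (venture CertifiedArithmetic / cell `pub-lowprec`): certified error envelopes and
provably optimal rounding/accumulation schemes for low-precision formats under stated cost models;
every table by two implementations; no hardware or vendor claims.

Order structure of the finite value set `F_φ` of a format, stated on VALUES (no new definitions;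
the ulp of a datum `v` is `2^(expCode v - 1)` quanta as in `Sterbenz.lean`):
* SUCCESSOR: a value strictly above a nonnegative value `v` is at least `v + ulp(v)`
  (`MiniFloat.add_ulp_le_of_lt`), and if any value lies above `v` then `v + ulp(v)` is a value
  (`MiniFloat.exists_toRat_eq_add_ulp`) [BoldoMelquiond2017, §3.1.3 (successor)];
* BRACKET: for `0 < s < maxRat` not a value, `v = roundDown φ s` satisfies `v < s < v + ulp(v)`,
  `v + ulp(v)` is a value, and no value lies strictly between (`MiniFloat.roundDown_bracket`);
* UNIQUE NEAREST: a value strictly closer to `x` than every other value is `fl(x)`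
  (`MiniFloat.toRat_roundNE_eq_of_forall_lt`); on `[v, v + ulp/2)` that value is `v`, on
  `(v + ulp/2, v + ulp]` it is `v + ulp` (`forall_lt_of_mem_low/high`);
* MIDPOINTS ARE FINER VALUES: the midpoint `v + ulp(v)/2` is a value of every format `ψ` with
  `m_φ + 1 ≤ m_ψ`, `bias_φ ≤ bias_ψ`, `maxRat φ ≤ maxRat ψ` (`MiniFloat.exists_toRat_eq_midpoint`;
  quanta related by `quantum_eq_pow_mul_quantum`);
* `toRat_top`, positive-side saturation `toRat_roundNE_of_maxRat_le_pos`.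
This is the toolkit of the double rounding theorem (`DoubleRounding.lean`).
-/

namespace Literature.ComputerArithmetic.FloatingPoint

namespace MiniFloat

open Format

variable {φ ψ : Format}

/-! ### Generic tools: unique nearest value, successor structure, saturation -/

/-- If SOME intermediate rounding is exact (`t` is a `ψ`-value) then double rounding through `ψ`
is trivially innocuous. [folklore] -/
theorem toRat_roundNE_roundNE_of_exists {t : ℚ} (h : ∃ z : MiniFloat ψ, z.toRat = t) :
    (roundNE φ (roundNE ψ t).toRat).toRat = (roundNE φ t).toRat := by
  rw [toRat_roundNE_of_exists h]

/-- UNIQUE NEAREST: if the value `c` of some datum is STRICTLY closer to `x` than every other value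
of `φ`, then `fl(x) = c`. [folklore] -/
theorem toRat_roundNE_eq_of_forall_lt {x c : ℚ} (hc : ∃ y : MiniFloat φ, y.toRat = c)
    (h : ∀ y : MiniFloat φ, y.toRat ≠ c → |x - c| < |x - y.toRat|) : (roundNE φ x).toRat = c := by
  by_contra hne
  obtain ⟨yc, hyc⟩ := hc
  have h1 := roundNE_nearest (φ := φ) x yc
  rw [hyc] at h1
  exact absurd (lt_of_lt_of_le (h _ hne) h1) (lt_irrefl _)

/-- A datum of nonnegative value has `toInt = scaledMag`. [folklore] -/
theorem toInt_eq_scaledMag_of_nonneg {v : MiniFloat φ} (hv : 0 ≤ v.toRat) :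
    v.toInt = v.scaledMag := by
  have hq := φ.quantum_pos
  have h0 : (0 : ℚ) ≤ v.toInt := by
    rw [toRat_eq_toInt_mul] at hv; exact nonneg_of_mul_nonneg_left hv hq
  have h0' : 0 ≤ v.toInt := by exact_mod_cast h0
  rw [← natAbs_toInt, Int.natAbs_of_nonneg h0']

/-- `top` has value `maxRat`. [folklore] -/
theorem toRat_top : (top φ).toRat = φ.maxRat := by
  unfold toRat toInt Format.maxRat
  rw [show (top φ).neg = false from rfl]
  simp

/-- `scaledMag v + ulp(v) ≤ 2^(p + ulpExp v)`: the successor magnitude stays within `p` bits over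
the ulp (it may be the next power of two). [folklore] -/
theorem scaledMag_add_ulp_le (v : MiniFloat φ) :
    v.scaledMag + 2 ^ (v.expCode - 1) ≤ 2 ^ (φ.manBits + 1 + (v.expCode - 1)) := by
  obtain ⟨c, hc⟩ := pow_ulpExp_dvd_scaledMag v
  have hlt := scaledMag_lt_pow_ulpExp v
  rw [hc, pow_add, mul_comm (2 ^ (φ.manBits + 1)) (2 ^ (v.expCode - 1))] at hlt
  have hc' : c < 2 ^ (φ.manBits + 1) := Nat.lt_of_mul_lt_mul_left hlt
  calc v.scaledMag + 2 ^ (v.expCode - 1) = 2 ^ (v.expCode - 1) * (c + 1) := by rw [hc]; ring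
    _ ≤ 2 ^ (v.expCode - 1) * 2 ^ (φ.manBits + 1) := Nat.mul_le_mul_left _ hc'
    _ = 2 ^ (φ.manBits + 1 + (v.expCode - 1)) := by rw [← pow_add]; ring_nf

/-- Value form: `v + ulp(v) ≤ 2^(p + ulpExp v) · quantum` for `v ≥ 0`. [folklore] -/
theorem toRat_add_ulp_le {v : MiniFloat φ} (hv : 0 ≤ v.toRat) :
    v.toRat + 2 ^ (v.expCode - 1) * φ.quantum ≤ 2 ^ (φ.manBits + 1 + (v.expCode - 1)) * φ.quantum := by
  have hq := φ.quantum_pos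
  have h1 : ((v.scaledMag + 2 ^ (v.expCode - 1) : ℕ) : ℚ) ≤ ((2 ^ (φ.manBits + 1 + (v.expCode - 1)) : ℕ) : ℚ) := by
    exact_mod_cast scaledMag_add_ulp_le v
  rw [toRat_eq_toInt_mul, toInt_eq_scaledMag_of_nonneg hv]
  push_cast at h1 ⊢
  nlinarith

/-- SUCCESSOR GAP: a value of `φ` strictly above a nonnegative value `v` is at least
`v + ulp(v)`, `ulp(v) = 2^(expCode v - 1)` quanta. [cite: BoldoMelquiond2017, §3.1.3] -/
theorem add_ulp_le_of_lt {v y : MiniFloat φ} (hv : 0 ≤ v.toRat) (hvy : v.toRat < y.toRat) :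
    v.toRat + 2 ^ (v.expCode - 1) * φ.quantum ≤ y.toRat := by
  have hq := φ.quantum_pos
  have hy0 : 0 ≤ y.toRat := le_of_lt (lt_of_le_of_lt hv hvy)
  have hmag : v.scaledMag ≤ y.scaledMag :=
    scaledMag_le_of_abs_le (by rw [abs_of_nonneg hv, abs_of_nonneg hy0]; exact hvy.le)
  have h1 : ((2 ^ (v.expCode - 1) : ℕ) : ℤ) ∣ y.toInt := pow_ulpExp_dvd_toInt hmag
  have h2 : ((2 ^ (v.expCode - 1) : ℕ) : ℤ) ∣ v.toInt := pow_ulpExp_dvd_toInt le_rfl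
  have hlt : v.toInt < y.toInt := by
    rw [toRat_eq_toInt_mul, toRat_eq_toInt_mul] at hvy
    exact_mod_cast lt_of_mul_lt_mul_right hvy hq.le
  have h3 : ((2 ^ (v.expCode - 1) : ℕ) : ℤ) ≤ y.toInt - v.toInt :=
    Int.le_of_dvd (by omega) (dvd_sub h1 h2)
  rw [toRat_eq_toInt_mul y, toRat_eq_toInt_mul v]
  have h4 : ((v.toInt : ℚ) + 2 ^ (v.expCode - 1)) ≤ (y.toInt : ℚ) := by
    have : (((2 ^ (v.expCode - 1) : ℕ) : ℤ) : ℚ) ≤ ((y.toInt - v.toInt : ℤ) : ℚ) := by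
      exact_mod_cast h3
    push_cast at this; linarith
  nlinarith

/-- SUCCESSOR EXISTS: if some value of `φ` lies strictly above the nonnegative value `v`, then
`v + ulp(v)` is a value of `φ`. [cite: BoldoMelquiond2017, §3.1.3] -/
theorem exists_toRat_eq_add_ulp {v y : MiniFloat φ} (hv : 0 ≤ v.toRat) (hvy : v.toRat < y.toRat) :
    ∃ u : MiniFloat φ, u.toRat = v.toRat + 2 ^ (v.expCode - 1) * φ.quantum := by
  have hq := φ.quantum_pos
  have hV := toInt_eq_scaledMag_of_nonneg hv
  -- the magnitude `scaledMag v + 2^e`, `e = expCode v - 1`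
  have hdvd : 2 ^ (v.expCode - 1) ∣ v.scaledMag + 2 ^ (v.expCode - 1) :=
    dvd_add (pow_ulpExp_dvd_scaledMag v) dvd_rfl
  have hsize := scaledMag_add_ulp_le v
  have hmax : v.scaledMag + 2 ^ (v.expCode - 1) ≤ φ.maxScaled := by
    have h1 := add_ulp_le_of_lt hv hvy
    have h2 := le_trans h1 (le_trans (le_abs_self _) (abs_toRat_le_maxRat y))
    rw [toRat_eq_toInt_mul, hV] at h2
    unfold Format.maxRat at h2
    push_cast at h2
    have h3 : ((v.scaledMag : ℚ) + 2 ^ (v.expCode - 1)) * φ.quantum ≤ (φ.maxScaled : ℚ) * φ.quantum :=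
      by linarith
    have h4 := le_of_mul_le_mul_right h3 hq
    exact_mod_cast h4
  have hrep : φ.Representable (v.scaledMag + 2 ^ (v.expCode - 1)) :=
    representable_of_pow_dvd hdvd hsize hmax
  have hrep' : φ.Representable (((v.scaledMag + 2 ^ (v.expCode - 1) : ℕ) : ℤ)).natAbs := by
    rw [Int.natAbs_natCast]; exact hrep
  obtain ⟨u, hu⟩ := exists_toRat_eq_intCast_mul _ hrep'
  refine ⟨u, ?_⟩
  rw [hu, toRat_eq_toInt_mul, hV]
  push_cast; ring

/-- SATURATION (positive side): `fl(x) = maxRat` for every `x ≥ maxRat`. [cite: RouhaniEtAl2023MX, §3] -/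
theorem toRat_roundNE_of_maxRat_le_pos {x : ℚ} (h : φ.maxRat ≤ x) :
    (roundNE φ x).toRat = φ.maxRat := by
  have hq := φ.quantum_pos
  have hmr : 0 ≤ φ.maxRat := mul_nonneg (Nat.cast_nonneg _) hq.le
  have h0 : 0 ≤ (roundNE φ x).toRat := by
    have := toRat_roundNE_mono (φ := φ) (le_trans hmr h)
    rwa [toRat_roundNE_zero] at this
  have h1 := abs_toRat_roundNE_of_maxRat_le (φ := φ) (le_trans h (le_abs_self x))
  rwa [abs_of_nonneg h0] at h1

/-! ### The bracket around a non-value: `v = RD(s) < s < v + ulp(v)` -/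

/-- BRACKET: for `0 < s < maxRat` not a value of `φ`, `v = roundDown φ s` is a nonnegative value
with `v < s < v + G`, `G = ulp(v)`; `v + G` is a value; and no value of `φ` lies strictly between
`v` and `v + G`. [cite: BoldoMelquiond2017, §3.1.3] -/
theorem roundDown_bracket {s : ℚ} (hs0 : 0 < s) (hs1 : s < φ.maxRat)
    (hns : ¬ ∃ y : MiniFloat φ, y.toRat = s) :
    0 ≤ (roundDown φ s).toRat ∧ (roundDown φ s).toRat < s ∧
    s < (roundDown φ s).toRat + 2 ^ ((roundDown φ s).expCode - 1) * φ.quantum ∧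
    (∃ u : MiniFloat φ,
      u.toRat = (roundDown φ s).toRat + 2 ^ ((roundDown φ s).expCode - 1) * φ.quantum) ∧
    (∀ y : MiniFloat φ, y.toRat ≤ (roundDown φ s).toRat ∨
      (roundDown φ s).toRat + 2 ^ ((roundDown φ s).expCode - 1) * φ.quantum ≤ y.toRat) := by
  have habs : |s| ≤ φ.maxRat := by rw [abs_of_pos hs0]; exact hs1.le
  have hv0 : 0 ≤ (roundDown φ s).toRat := by
    have := toRat_le_roundDown habs (zero φ) (by rw [toRat_zero]; exact hs0.le)
    rwa [toRat_zero] at this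
  have hvle : (roundDown φ s).toRat ≤ s := toRat_roundDown_le habs
  have hvlt : (roundDown φ s).toRat < s := lt_of_le_of_ne hvle (fun h => hns ⟨_, h⟩)
  have hvtop : (roundDown φ s).toRat < (top φ).toRat := by rw [toRat_top]; linarith
  obtain ⟨u, hu⟩ := exists_toRat_eq_add_ulp hv0 hvtop
  have hG : (0 : ℚ) < 2 ^ ((roundDown φ s).expCode - 1) * φ.quantum := by
    have := φ.quantum_pos; positivity
  have hsu : s < (roundDown φ s).toRat + 2 ^ ((roundDown φ s).expCode - 1) * φ.quantum := by
    by_contra h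
    have h' : u.toRat ≤ s := by rw [hu]; exact not_lt.mp h
    have := toRat_le_roundDown habs u h'
    rw [hu] at this
    linarith
  refine ⟨hv0, hvlt, hsu, ⟨u, hu⟩, fun y => ?_⟩
  by_cases hy : y.toRat ≤ s
  · exact Or.inl (toRat_le_roundDown habs y hy)
  · exact Or.inr (add_ulp_le_of_lt hv0 (by linarith))

/-- The two quanta: `quantum φ = 2^((m_ψ - m_φ) + (bias_ψ - bias_φ)) · quantum ψ` when
`m_φ ≤ m_ψ` and `bias_φ ≤ bias_ψ`. [folklore] -/
theorem quantum_eq_pow_mul_quantum (hm : φ.manBits ≤ ψ.manBits) (hb : φ.bias ≤ ψ.bias) :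
    φ.quantum = 2 ^ ((ψ.manBits - φ.manBits) + (ψ.bias - φ.bias)) * ψ.quantum := by
  unfold Format.quantum Format.qexp
  rw [← zpow_natCast, ← zpow_add₀ (by norm_num : (2:ℚ) ≠ 0)]
  congr 1
  push_cast [Nat.cast_sub hm, Nat.cast_sub hb]
  ring

/-- `qexp ψ ≤ qexp φ` under the same hypotheses. [folklore] -/
theorem qexp_le_of_le (hm : φ.manBits ≤ ψ.manBits) (hb : φ.bias ≤ ψ.bias) : ψ.qexp ≤ φ.qexp := by
  unfold Format.qexp; omega

/-- THE MIDPOINT IS A WIDE VALUE: for a value `v ≥ 0` of `φ` whose successor `v + ulp(v)` is a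
value, the midpoint `v + ulp(v)/2` is a value of any `ψ` with `m_φ + 1 ≤ m_ψ`, `bias_φ ≤ bias_ψ`,
`maxRat φ ≤ maxRat ψ`. [folklore] -/
theorem exists_toRat_eq_midpoint (hm : φ.manBits + 1 ≤ ψ.manBits) (hb : φ.bias ≤ ψ.bias)
    (hmax : φ.maxRat ≤ ψ.maxRat) {v u : MiniFloat φ} (hv : 0 ≤ v.toRat)
    (hu : u.toRat = v.toRat + 2 ^ (v.expCode - 1) * φ.quantum) :
    ∃ z : MiniFloat ψ, z.toRat = v.toRat + 2 ^ (v.expCode - 1) * φ.quantum / 2 := by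
  have hqφ := φ.quantum_pos
  have hqψ := ψ.quantum_pos
  obtain ⟨t, ht⟩ : ∃ t, (ψ.manBits - φ.manBits) + (ψ.bias - φ.bias) = t + 1 :=
    ⟨(ψ.manBits - φ.manBits) + (ψ.bias - φ.bias) - 1, by omega⟩
  have hquant : φ.quantum = 2 * 2 ^ t * ψ.quantum := by
    rw [quantum_eq_pow_mul_quantum (by omega) hb, ht, pow_succ]; ring
  set e := v.expCode - 1 with he
  have hV := toInt_eq_scaledMag_of_nonneg hv
  -- the candidate magnitude in `ψ`-quanta
  set n : ℕ := (2 * v.scaledMag + 2 ^ e) * 2 ^ t with hn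
  have hval : (n : ℚ) * ψ.quantum = v.toRat + 2 ^ e * φ.quantum / 2 := by
    rw [toRat_eq_toInt_mul, hV, hquant, hn]; push_cast; ring
  have hdvd : 2 ^ (e + t) ∣ n := by
    rw [hn, pow_add]
    exact Nat.mul_dvd_mul (dvd_add (dvd_mul_of_dvd_right (pow_ulpExp_dvd_scaledMag v) 2) dvd_rfl)
      dvd_rfl
  have hsize : n ≤ 2 ^ (ψ.manBits + 1 + (e + t)) := by
    have h1 := scaledMag_add_ulp_le v
    rw [← he] at h1
    calc n = (2 * v.scaledMag + 2 ^ e) * 2 ^ t := hn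
      _ ≤ (2 * 2 ^ (φ.manBits + 1 + e)) * 2 ^ t :=
          Nat.mul_le_mul_right _ (by have := @Nat.one_le_two_pow e; omega)
      _ = 2 ^ (φ.manBits + 2 + (e + t)) := by rw [← pow_succ', ← pow_add]; ring_nf
      _ ≤ 2 ^ (ψ.manBits + 1 + (e + t)) := Nat.pow_le_pow_right (by norm_num) (by omega)
  have hmaxn : n ≤ ψ.maxScaled := by
    have hG : (0:ℚ) ≤ 2 ^ e * φ.quantum := by positivity
    have h1 : (n : ℚ) * ψ.quantum ≤ ψ.maxRat := by
      rw [hval]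
      calc v.toRat + 2 ^ e * φ.quantum / 2 ≤ u.toRat := by rw [hu]; linarith
        _ ≤ φ.maxRat := le_trans (le_abs_self _) (abs_toRat_le_maxRat u)
        _ ≤ ψ.maxRat := hmax
    unfold Format.maxRat at h1
    exact_mod_cast le_of_mul_le_mul_right h1 hqψ
  have hrep : ψ.Representable n := representable_of_pow_dvd hdvd hsize hmaxn
  have hrep' : ψ.Representable ((n : ℤ)).natAbs := by rw [Int.natAbs_natCast]; exact hrep
  obtain ⟨z, hz⟩ := exists_toRat_eq_intCast_mul _ hrep'
  exact ⟨z, by rw [hz, ← hval]; push_cast; ring⟩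

/-! ### `fl_φ` is locally constant on each half of the bracket -/

/-- On `[v, v + G/2)` the unique nearest value is `v`. [folklore] -/
theorem forall_lt_of_mem_low {v : MiniFloat φ} {G x : ℚ}
    (hgap : ∀ y : MiniFloat φ, y.toRat ≤ v.toRat ∨ v.toRat + G ≤ y.toRat)
    (hx1 : v.toRat ≤ x) (hx2 : x < v.toRat + G / 2) :
    ∀ y : MiniFloat φ, y.toRat ≠ v.toRat → |x - v.toRat| < |x - y.toRat| := by
  intro y hy
  rw [abs_of_nonneg (by linarith : 0 ≤ x - v.toRat)]
  rcases hgap y with h | h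
  · have h' : y.toRat < v.toRat := lt_of_le_of_ne h hy
    rw [abs_of_nonneg (by linarith : 0 ≤ x - y.toRat)]; linarith
  · rw [abs_of_nonpos (by linarith : x - y.toRat ≤ 0)]; linarith

/-- On `(v + G/2, v + G]` the unique nearest value is `v + G`. [folklore] -/
theorem forall_lt_of_mem_high {v u : MiniFloat φ} {G x : ℚ} (hu : u.toRat = v.toRat + G)
    (hgap : ∀ y : MiniFloat φ, y.toRat ≤ v.toRat ∨ v.toRat + G ≤ y.toRat)
    (hx1 : v.toRat + G / 2 < x) (hx2 : x ≤ v.toRat + G) :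
    ∀ y : MiniFloat φ, y.toRat ≠ u.toRat → |x - u.toRat| < |x - y.toRat| := by
  intro y hy
  rw [hu] at hy ⊢
  rw [abs_of_nonpos (by linarith : x - (v.toRat + G) ≤ 0)]
  rcases hgap y with h | h
  · rw [abs_of_nonneg (by linarith : 0 ≤ x - y.toRat)]; linarith
  · have h' : v.toRat + G < y.toRat := lt_of_le_of_ne h (Ne.symm hy)
    rw [abs_of_nonpos (by linarith : x - y.toRat ≤ 0)]; linarith

end MiniFloat

end Literature.ComputerArithmetic.FloatingPoint
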